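import Summits.MatrixMultiplication.MatrixMultiplication.Theorems.AbelianSTPPCensusShapeCertVQDefsE

/-!
# Abelian STPP census — kernel evaluation of the budgeted vQ certificate checker `ShapeCertVQ.checkQE` (orders 405–406)

Cell mm-stpp, rung F-M1; successor kernel item VQ-CERT (T_E beyond 337 under vQ := vP ∧ E3⁺) in support of the closed crux item
stmt-MatrixMultiplication-19191; seat mm-stpp-vp-p2 (gen 1); support file (no definitions).  `ShapeCertVQ.checkQE M = true`
(`…ShapeCertVQDefsE`: the vQ search with the E3⁺ continuation budget) by `decide +kernel` (no `native_decide`, standard axioms), one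
theorem per order, or — where one evaluation would exceed the gate's per-declaration budget (≈ 10⁴ candidate visits of the budgeted
search) — the order's ROOT SEGMENTS `ShapeCertVQ.rootSegQE M i n` (≤ 6·10³ visits each where the tree allows; seat sizing
calc/segplanE6k_396_415.txt), assembled into `checkQE M = true` by `ShapeCertVQ.checkQE_of_root` in the leaf file; `Elab.async false` keeps
the kernel evaluations sequential.  Soundness: `ShapeCertVQ.checkQE_sound` (`…ShapeCertVQSearchE`), bridge
`ShapeCertVQ.shapeExclusionVQ_of_checkQE` (`…ShapeCertVQFinalE`).
WHAT THIS IS NOT: Boolean evaluations; no statement about STPP families or `ω` by themselves.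
-/

set_option linter.dupNamespace false -- `MatrixMultiplication.MatrixMultiplication` (summit = problem, D-0017)
set_option autoImplicit false
set_option Elab.async false -- sequential kernel evaluations (memory high-water of one order at a time)

namespace Summit.MatrixMultiplication.MatrixMultiplication.Theorems.ShapeCertVQ

set_option maxHeartbeats 0 in
/-- root segment of the budgeted vQ certificate at order `405`: candidates `0 … 94` (≈ 4185 candidate visits; kernel evaluation) -/
theorem rootSegQE_405_0 : rootSegQE 405 0 95 = true := by
  decide +kernel

set_option maxHeartbeats 0 in
/-- root segment of the budgeted vQ certificate at order `405`: candidates `95 … 103` (≈ 5785 candidate visits; kernel evaluation) -/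
theorem rootSegQE_405_95 : rootSegQE 405 95 9 = true := by
  decide +kernel

set_option maxHeartbeats 0 in
/-- root segment of the budgeted vQ certificate at order `405`: candidates `104 …` (≈ 5708 candidate visits; kernel evaluation) -/
theorem rootSegQE_405_104 : rootSegQE 405 104 9999 = true := by
  decide +kernel

set_option maxHeartbeats 0 in
/-- root segment of the budgeted vQ certificate at order `406`: candidates `0 … 94` (≈ 4164 candidate visits; kernel evaluation) -/
theorem rootSegQE_406_0 : rootSegQE 406 0 95 = true := by
  decide +kernel

set_option maxHeartbeats 0 in
/-- root segment of the budgeted vQ certificate at order `406`: candidates `95 … 104` (≈ 5944 candidate visits; kernel evaluation) -/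
theorem rootSegQE_406_95 : rootSegQE 406 95 10 = true := by
  decide +kernel

set_option maxHeartbeats 0 in
/-- root segment of the budgeted vQ certificate at order `406`: candidates `105 …` (≈ 5431 candidate visits; kernel evaluation) -/
theorem rootSegQE_406_105 : rootSegQE 406 105 9999 = true := by
  decide +kernel

end Summit.MatrixMultiplication.MatrixMultiplication.Theorems.ShapeCertVQ
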